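/-
Copyright (c) 2026 the pub-hodgecm-mathlib formalisation cell (harness21).  Prover seat hodgecm-mathlib-K2E1-p15 (g0), Track B ∕ K2-LIT «5Res», h413 = `stmt-HodgeConjecture-24833`,
line `K2_E1_TraceFormulaBeta`, route of record `HCCMUnconditional`; K2E1-p10 (g2)'s F3d split (dealer K2E1-plan (g7) (232)), brick F3b′ «continuity ∕ support ∕ bound ∕ height
band of the Borel periodisation of a nice test function» (K2E1-p10 spec `K2/STATUS.md` 2026-09-04T12:41:06Z).
-/
import Summits.HodgeConjecture.HodgeConjecture.Theorems.K2E1PseudoEisensteinBorelPeriodizationU2   -- ★ F3b p860200 (K2E1-p10): the periodisation `ψ`, `inv_periodization_borel_mul`, `inv_periodization_unipotent_mul`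
import Summits.HodgeConjecture.HodgeConjecture.Theorems.K2E1BLInvariantSigmaDescentU              -- ★ (K2-defs1): `isClosed_arithmeticSubgroup_quasiSplit` (+ Lit `torusPart_mem_arithmeticSubgroup`)
import Summits.HodgeConjecture.HodgeConjecture.Theorems.K2E1BLIotaUnfoldingU                     -- ★ (K2E4-p10): `borelHeight_arithmeticBorel_mul'`; brings ★ BL defs (`adelicUnipBorelSubgroup`, `ratBorelSubgroup`)
import Literature.NumberTheory.Automorphic.UnitaryGroupTorusSiegelIntegral                         -- ★ `borelHeight_pos`, `continuous_borelHeight`, `torusPart` API (BorelSemidirect)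
import HarnessLib

/-!
# K2·E1 — `K2E1PseudoEisensteinBorelPeriodizationContinuousU2`: THE BOREL PERIODISATION `ψ(h) = Σ'_{q ∈ B(F)⧸(B(F)∩N(𝔸))} Φ(h⁻¹ q̃)` OF A NICE TEST FUNCTION IS A
# LOCALLY FINITE SUM — CONTINUOUS, SUPPORTED IN `N(𝔸)B(F)·C⁻¹`, BOUNDED, AND LIVES IN A HEIGHT BAND (F3b′ of K2E1-p10's F3d chain)

Track B ∕ K2-LIT, crux h413 = `stmt-HodgeConjecture-24833`; cell `hodgecm-mathlib`, squad K2, ENGINE E1, ROADCARD C7 (b)(c) «families».  THEOREMS ONLY (no `def`, no `instance`, no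
notation, no named-fact hypothesis, no `sorry`); lane `--kind proof --supports stmt-HodgeConjecture-24833 --as helper` (count-neutral).  Closes no socket.

SETTING ([MoeglinWaldspurger1995, II.1.1–II.1.3]; [Garrett2018, §2.10]).  `G = U(Φ_N)(𝔸_F)` (★ `quasiSplit F E c N`), `B(F)` = ★ `arithmeticBorel` (inside `G(F)` = ★ `arithmeticSubgroup`),
`N(𝔸)` = ★ `adelicUnipotent`; a NICE test function `Φ : G → ℂ`: continuous, right-`N(𝔸)`-invariant, vanishing off `C·N(𝔸)` with `C` compact (★ P1b's generators).  Its Borel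
periodisation (★ F3b, written INLINE in every statement) `ψ(h) := Σ'_{q ∈ B(F)⧸(B(F) ∩ N(𝔸))} Φ(h⁻¹ q̃)`.
* §1 (L0) **`finite_setOf_exists_apply_ne_zero`** — LOCAL FINITENESS: for compact `D`, only finitely many classes `q` have `Φ(h⁻¹q̃) ≠ 0` for some `h ∈ D`.  Proof by the TORUS-PART
  INJECTION: `q ↦ torusPart(q̃) ∈ T(𝔸) ∩ G(F)` is injective on `B(F)⧸(B(F)∩N(𝔸))` (★ `mem_unipotentInBorel_iff_torusPart_eq_one`), and for such `q`, `q̃ n⁻¹ ∈ D·C` for some `n ∈ N(𝔸)`,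
  so `torusPart(q̃) = torusPart(q̃ n⁻¹) ∈ torusPart(B(𝔸) ∩ D·C)`, a compact set (★ `isClosed_borelAdelic`, ★ `continuous_torusPart`), met with the closed discrete `G(F)` (★
  `isDiscreteRational_quasiSplit`, ★ `isClosed_arithmeticSubgroup_quasiSplit`) in a finite set.  No restriction on `N`.
* §2 (L2) **`inv_periodization_eq_zero_of_not_mem`** (`ψ = 0` off `N(𝔸)B(F)·C⁻¹`), (L2′) **`inv_periodization_adelicUnipBorel_mul`** (`ψ` is left-invariant under the whole subgroup
  `N(𝔸)B(F)` = ★ `adelicUnipBorelSubgroup`, by `Subgroup.closure_induction` from ★ F3b's two invariances), **`borelHeight_adelicUnipBorel_mul`** (so is the height `H`).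
* §3 (L1) **`continuous_inv_periodization`** (locally finite sum of continuous functions; `[LocallyCompactSpace G]` as an instance hypothesis), (L3) **`exists_bound_inv_periodization`**
  (`sup |ψ| = sup_{C⁻¹} |ψ|`), (L4) **`exists_band_of_inv_periodization_ne_zero`** (`ψ h ≠ 0 ⇒ a ≤ H(h) ≤ b` with `a > 0`: `H(ψ ≠ 0) ⊆ H(C⁻¹)`).

HONEST LABEL: HC_CM is proved only modulo the 7 printed citations (2 remaining named inputs: hLiu418 = `stmt-HodgeConjecture-24832`, h413 = `stmt-HodgeConjecture-24833`) until rung 0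
closes; this file asserts no named fact and closes no socket.

## References
* [MoeglinWaldspurger1995] C. Mœglin, J.-L. Waldspurger, *Spectral decomposition and Eisenstein series* (1995), II.1.1–II.1.3.
* [Garrett2018] P. Garrett, *Modern Analysis of Automorphic Forms by Example* (2018), §2.10.
* [Rogawski1990] J. Rogawski, *Automorphic representations of unitary groups in three variables* (1990), §1.10.
-/

set_option autoImplicit false
set_option linter.dupNamespace false  -- the mandated namespace repeats the summit's segment (`HodgeConjecture.HodgeConjecture`)

noncomputable section

open MeasureTheory Set Filter Topology NumberField
open scoped NNReal Pointwise
open Literature.NumberTheory.Automorphic Literature.NumberTheory.Automorphic.UnitaryGroup AdelicGroupData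
open Summit.HodgeConjecture.HodgeConjecture.Cruxes.H413.K2E1BLBorelSpacesU2Defs
open Summit.HodgeConjecture.HodgeConjecture.Cruxes.H413.K2E1BLInvariantSigmaDescentU (isClosed_arithmeticSubgroup_quasiSplit)
open Summit.HodgeConjecture.HodgeConjecture.Cruxes.H413.K2E1BLIotaUnfoldingU (borelHeight_arithmeticBorel_mul')
open Summit.HodgeConjecture.HodgeConjecture.Cruxes.H413.K2E1PseudoEisensteinBorelPeriodizationU2 (inv_periodization_borel_mul inv_periodization_unipotent_mul)

namespace Summit.HodgeConjecture.HodgeConjecture.Cruxes.H413.K2E1PseudoEisensteinBorelPeriodizationContinuousU2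

variable {F E : Type} [Field F] [NumberField F] [Field E] [NumberField E] [Algebra F E] {c : E ≃ₐ[F] E} {N : ℕ}

/-! ## §1 Local finiteness of the periodisation (the torus-part injection) -/

/-- **The torus part of a class of `B(F)⧸(B(F) ∩ N(𝔸))` determines the class**: if `q̃₁, q̃₂ ∈ B(F)` have the same torus part then `q̃₁⁻¹q̃₂ ∈ N(𝔸)` (★
`mem_unipotentInBorel_iff_torusPart_eq_one`), i.e. `q₁ = q₂`. [cite: Rogawski1990, §1.10] [cite: MoeglinWaldspurger1995, II.1.1] -/
theorem quotient_eq_of_torusPart_eq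
    (q₁ q₂ : ↥(arithmeticBorel F E c N) ⧸ ((adelicUnipotent F E c N).subgroupOf (quasiSplit F E c N).arithmeticSubgroup).subgroupOf (arithmeticBorel F E c N))
    (h : torusPart (⟨(((q₁.out : arithmeticBorel F E c N) : (quasiSplit F E c N).arithmeticSubgroup) : (quasiSplit F E c N).Adelic), (mem_arithmeticBorel_iff _).1 q₁.out.2⟩ : borelAdelic F E c N) =
      torusPart (⟨(((q₂.out : arithmeticBorel F E c N) : (quasiSplit F E c N).arithmeticSubgroup) : (quasiSplit F E c N).Adelic), (mem_arithmeticBorel_iff _).1 q₂.out.2⟩ : borelAdelic F E c N)) :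
    q₁ = q₂ := by
  set b₁ : borelAdelic F E c N := ⟨(((q₁.out : arithmeticBorel F E c N) : (quasiSplit F E c N).arithmeticSubgroup) : (quasiSplit F E c N).Adelic), (mem_arithmeticBorel_iff _).1 q₁.out.2⟩ with hb₁
  set b₂ : borelAdelic F E c N := ⟨(((q₂.out : arithmeticBorel F E c N) : (quasiSplit F E c N).arithmeticSubgroup) : (quasiSplit F E c N).Adelic), (mem_arithmeticBorel_iff _).1 q₂.out.2⟩ with hb₂
  have h1 : torusPart (1 : borelAdelic F E c N) = 1 := torusPart_eq_one_of_mem (Subgroup.one_mem _)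
  have hinv : torusPart b₁⁻¹ = (torusPart b₁)⁻¹ := by
    refine eq_inv_of_mul_eq_one_left ?_
    rw [← torusPart_mul, inv_mul_cancel, h1]
  have hT : torusPart (b₁⁻¹ * b₂) = 1 := by rw [torusPart_mul, hinv, h, inv_mul_cancel]
  have hN : (((b₁⁻¹ * b₂ : borelAdelic F E c N)) : (quasiSplit F E c N).Adelic) ∈ adelicUnipotent F E c N :=
    (mem_unipotentInBorel_iff _).1 ((mem_unipotentInBorel_iff_torusPart_eq_one _).2 hT)
  have hH : (q₁.out)⁻¹ * q₂.out ∈ ((adelicUnipotent F E c N).subgroupOf (quasiSplit F E c N).arithmeticSubgroup).subgroupOf (arithmeticBorel F E c N) := by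
    rw [Subgroup.mem_subgroupOf, Subgroup.mem_subgroupOf]
    exact hN
  rw [← QuotientGroup.out_eq' q₁, ← QuotientGroup.out_eq' q₂]
  exact QuotientGroup.eq.2 hH

/-- **(L0) LOCAL FINITENESS OF THE PERIODISATION**: for `Φ` right-`N(𝔸)`-invariant and vanishing off `C·N(𝔸)` (`C` compact) and every compact `D ⊆ G(𝔸)`, only finitely many classes
`q ∈ B(F)⧸(B(F) ∩ N(𝔸))` satisfy `Φ(h⁻¹ q̃) ≠ 0` for some `h ∈ D` (module docstring §1: the torus-part injection into the finite set `torusPart(B(𝔸) ∩ D·C) ∩ G(F)`).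
[cite: MoeglinWaldspurger1995, II.1.1 and II.1.3] [cite: Garrett2018, §2.10] -/
theorem finite_setOf_exists_apply_ne_zero {Φ : (quasiSplit F E c N).Adelic → ℂ}
    {C : Set (quasiSplit F E c N).Adelic} (hC : IsCompact C)
    (hCΦ : ∀ g, g ∉ C * ((adelicUnipotent F E c N : Subgroup (quasiSplit F E c N).Adelic) : Set (quasiSplit F E c N).Adelic) → Φ g = 0)
    {D : Set (quasiSplit F E c N).Adelic} (hD : IsCompact D) :
    {q : ↥(arithmeticBorel F E c N) ⧸ ((adelicUnipotent F E c N).subgroupOf (quasiSplit F E c N).arithmeticSubgroup).subgroupOf (arithmeticBorel F E c N) |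
      ∃ h ∈ D, Φ (h⁻¹ * (((q.out : arithmeticBorel F E c N) : (quasiSplit F E c N).arithmeticSubgroup) : (quasiSplit F E c N).Adelic)) ≠ 0}.Finite := by
  classical
  haveI : DiscreteTopology (quasiSplit F E c N).arithmeticSubgroup := isDiscreteRational_quasiSplit
  -- the torus-part map on classes
  set T : (↥(arithmeticBorel F E c N) ⧸ ((adelicUnipotent F E c N).subgroupOf (quasiSplit F E c N).arithmeticSubgroup).subgroupOf (arithmeticBorel F E c N)) →
      (quasiSplit F E c N).Adelic := fun q =>
    ((torusPart (⟨(((q.out : arithmeticBorel F E c N) : (quasiSplit F E c N).arithmeticSubgroup) : (quasiSplit F E c N).Adelic), (mem_arithmeticBorel_iff _).1 q.out.2⟩ :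
      borelAdelic F E c N) : borelAdelic F E c N) : (quasiSplit F E c N).Adelic) with hT
  have hTinj : Function.Injective T := fun q₁ q₂ h => quotient_eq_of_torusPart_eq q₁ q₂ (Subtype.ext h)
  -- the compact target `torusPart(B(𝔸) ∩ D·C)` and its finite trace on `G(F)`
  set K : Set (quasiSplit F E c N).Adelic :=
    ((↑) : borelAdelic F E c N → (quasiSplit F E c N).Adelic) '' (torusPart '' {b : borelAdelic F E c N | (b : (quasiSplit F E c N).Adelic) ∈ D * C}) with hK
  have hKc : IsCompact K :=
    (((isClosed_borelAdelic (F := F) (E := E) (c := c) (N := N)).isClosedEmbedding_subtypeVal.isCompact_preimage (hD.mul hC)).image continuous_torusPart).image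
      continuous_subtype_val
  have hfin : (K ∩ ((quasiSplit F E c N).arithmeticSubgroup : Set (quasiSplit F E c N).Adelic)).Finite := by
    have h1 : ((((↑) : (quasiSplit F E c N).arithmeticSubgroup → (quasiSplit F E c N).Adelic)) ⁻¹' K).Finite :=
      ((isClosed_arithmeticSubgroup_quasiSplit (F := F) (E := E) (c := c) (N := N)).isClosedEmbedding_subtypeVal.isCompact_preimage hKc).finite_of_discrete
    have h2 := h1.image ((↑) : (quasiSplit F E c N).arithmeticSubgroup → (quasiSplit F E c N).Adelic)
    refine h2.subset ?_
    rintro g ⟨hgK, hgΓ⟩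
    exact ⟨⟨g, hgΓ⟩, hgK, rfl⟩
  -- the set injects into the finite trace
  refine (hfin.preimage hTinj.injOn).subset fun q hq => ?_
  obtain ⟨h, hh, hne⟩ := hq
  set β : (quasiSplit F E c N).Adelic := (((q.out : arithmeticBorel F E c N) : (quasiSplit F E c N).arithmeticSubgroup) : (quasiSplit F E c N).Adelic) with hβ
  have hβB : β ∈ borelAdelic F E c N := (mem_arithmeticBorel_iff _).1 q.out.2
  have hmem : h⁻¹ * β ∈ C * ((adelicUnipotent F E c N : Subgroup (quasiSplit F E c N).Adelic) : Set (quasiSplit F E c N).Adelic) := by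
    by_contra hn
    exact hne (hCΦ _ hn)
  obtain ⟨c₀, hc₀, n, hn, he⟩ := Set.mem_mul.1 hmem
  have hn' : n⁻¹ ∈ adelicUnipotent F E c N := Subgroup.inv_mem _ hn
  have hβn : β * n⁻¹ = h * c₀ := by
    have h1 : β = h * (c₀ * n) := by rw [he, mul_inv_cancel_left]
    rw [h1]; group
  set b' : borelAdelic F E c N := ⟨β * n⁻¹, Subgroup.mul_mem _ hβB (adelicUnipotent_le_borelAdelic hn')⟩ with hb'
  have hTq : T q = ((torusPart b' : borelAdelic F E c N) : (quasiSplit F E c N).Adelic) := by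
    have hsplit : b' = (⟨β, hβB⟩ : borelAdelic F E c N) * ⟨n⁻¹, adelicUnipotent_le_borelAdelic hn'⟩ := Subtype.ext rfl
    rw [hT]
    show ((torusPart (⟨β, hβB⟩ : borelAdelic F E c N) : borelAdelic F E c N) : (quasiSplit F E c N).Adelic) = _
    rw [hsplit, torusPart_mul, torusPart_eq_one_of_mem (u := (⟨n⁻¹, adelicUnipotent_le_borelAdelic hn'⟩ : borelAdelic F E c N)) hn', mul_one]
  refine ⟨?_, ?_⟩
  · rw [hTq]
    refine ⟨torusPart b', ⟨b', ?_, rfl⟩, rfl⟩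
    show β * n⁻¹ ∈ D * C
    rw [hβn]
    exact Set.mul_mem_mul hh hc₀
  · exact torusPart_mem_arithmeticSubgroup ((q.out : arithmeticBorel F E c N) : (quasiSplit F E c N).arithmeticSubgroup).2

/-! ## §2 Support and invariance under `N(𝔸)B(F)` -/

/-- **(L2′) `ψ` IS LEFT-INVARIANT UNDER THE WHOLE SUBGROUP `N(𝔸)B(F)`** (★ `adelicUnipBorelSubgroup = adelicUnipotent ⊔ ratBorelSubgroup`): `Subgroup.closure_induction` from ★ F3b's
invariances under `N(𝔸)` and `B(F)`. [cite: MoeglinWaldspurger1995, II.1.1] -/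
theorem inv_periodization_adelicUnipBorel_mul [NeZero N] {Φ : (quasiSplit F E c N).Adelic → ℂ}
    (hΦ : ∀ (g : (quasiSplit F E c N).Adelic) (u : adelicUnipotent F E c N), Φ (g * u) = Φ g)
    {x : (quasiSplit F E c N).Adelic} (hx : x ∈ adelicUnipBorelSubgroup F E c N) (h : (quasiSplit F E c N).Adelic) :
    (fun h : (quasiSplit F E c N).Adelic => ∑' q : ↥(arithmeticBorel F E c N) ⧸ ((adelicUnipotent F E c N).subgroupOf (quasiSplit F E c N).arithmeticSubgroup).subgroupOf (arithmeticBorel F E c N),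
        Φ (h⁻¹ * (((q.out : arithmeticBorel F E c N) : (quasiSplit F E c N).arithmeticSubgroup) : (quasiSplit F E c N).Adelic))) (x * h) =
      (fun h : (quasiSplit F E c N).Adelic => ∑' q : ↥(arithmeticBorel F E c N) ⧸ ((adelicUnipotent F E c N).subgroupOf (quasiSplit F E c N).arithmeticSubgroup).subgroupOf (arithmeticBorel F E c N),
        Φ (h⁻¹ * (((q.out : arithmeticBorel F E c N) : (quasiSplit F E c N).arithmeticSubgroup) : (quasiSplit F E c N).Adelic))) h := by
  set ψ := (fun h : (quasiSplit F E c N).Adelic => ∑' q : ↥(arithmeticBorel F E c N) ⧸ ((adelicUnipotent F E c N).subgroupOf (quasiSplit F E c N).arithmeticSubgroup).subgroupOf (arithmeticBorel F E c N),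
        Φ (h⁻¹ * (((q.out : arithmeticBorel F E c N) : (quasiSplit F E c N).arithmeticSubgroup) : (quasiSplit F E c N).Adelic))) with hψ
  revert h
  have hx' : x ∈ Subgroup.closure (((adelicUnipotent F E c N : Subgroup (quasiSplit F E c N).Adelic) : Set (quasiSplit F E c N).Adelic) ∪ (ratBorelSubgroup F E c N : Set (quasiSplit F E c N).Adelic)) := by
    rw [← Subgroup.sup_eq_closure]; exact hx
  refine Subgroup.closure_induction (p := fun x _ => ∀ h, ψ (x * h) = ψ h) ?_ ?_ ?_ ?_ hx'
  · rintro y (hy | hy) h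
    · exact inv_periodization_unipotent_mul hΦ ⟨y, hy⟩ h
    · obtain ⟨γ, hγ⟩ := hy.2
      have hmem : (⟨y, ⟨γ, hγ⟩⟩ : (quasiSplit F E c N).arithmeticSubgroup) ∈ arithmeticBorel F E c N := (mem_arithmeticBorel_iff _).2 hy.1
      exact inv_periodization_borel_mul hΦ ⟨y, ⟨γ, hγ⟩⟩ hmem h
  · intro h; rw [one_mul]
  · intro y z _ _ hy hz h
    rw [mul_assoc, hy, hz]
  · intro y _ hy h
    have := hy (y⁻¹ * h)
    rw [mul_inv_cancel_left] at this
    exact this.symm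

/-- **(L2) `ψ` VANISHES OFF `N(𝔸)B(F)·C⁻¹`**: if `Φ(h⁻¹ q̃) ≠ 0` then `h⁻¹ q̃ = c₀ n` with `c₀ ∈ C`, `n ∈ N(𝔸)`, so `h = (q̃ n⁻¹) c₀⁻¹ ∈ N(𝔸)B(F)·C⁻¹`. [cite: MoeglinWaldspurger1995, II.1.3] [cite: Garrett2018, §2.10] -/
theorem inv_periodization_eq_zero_of_not_mem [NeZero N] {Φ : (quasiSplit F E c N).Adelic → ℂ} {C : Set (quasiSplit F E c N).Adelic}
    (hCΦ : ∀ g, g ∉ C * ((adelicUnipotent F E c N : Subgroup (quasiSplit F E c N).Adelic) : Set (quasiSplit F E c N).Adelic) → Φ g = 0)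
    (h : (quasiSplit F E c N).Adelic) (hh : h ∉ ((adelicUnipBorelSubgroup F E c N : Subgroup (quasiSplit F E c N).Adelic) : Set (quasiSplit F E c N).Adelic) * C⁻¹) :
    (∑' q : ↥(arithmeticBorel F E c N) ⧸ ((adelicUnipotent F E c N).subgroupOf (quasiSplit F E c N).arithmeticSubgroup).subgroupOf (arithmeticBorel F E c N),
        Φ (h⁻¹ * (((q.out : arithmeticBorel F E c N) : (quasiSplit F E c N).arithmeticSubgroup) : (quasiSplit F E c N).Adelic))) = 0 := by
  refine (tsum_congr fun q => ?_).trans tsum_zero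
  by_contra hne
  set β : (quasiSplit F E c N).Adelic := (((q.out : arithmeticBorel F E c N) : (quasiSplit F E c N).arithmeticSubgroup) : (quasiSplit F E c N).Adelic) with hβ
  have hmem : h⁻¹ * β ∈ C * ((adelicUnipotent F E c N : Subgroup (quasiSplit F E c N).Adelic) : Set (quasiSplit F E c N).Adelic) := by
    by_contra hn
    exact hne (hCΦ _ hn)
  obtain ⟨c₀, hc₀, n, hn, he⟩ := Set.mem_mul.1 hmem
  have hβN : β * n⁻¹ ∈ adelicUnipBorelSubgroup F E c N := by
    refine Subgroup.mul_mem _ (Subgroup.mem_sup_right ⟨(mem_arithmeticBorel_iff _).1 q.out.2, ((q.out : arithmeticBorel F E c N) : (quasiSplit F E c N).arithmeticSubgroup).2⟩)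
      (Subgroup.mem_sup_left (Subgroup.inv_mem _ hn))
  have heq : h = β * n⁻¹ * c₀⁻¹ := by
    have h1 : β = h * (c₀ * n) := by rw [he, mul_inv_cancel_left]
    rw [h1]; group
  exact hh (heq ▸ Set.mul_mem_mul hβN (Set.inv_mem_inv.2 hc₀))

/-- **THE HEIGHT IS INVARIANT UNDER `N(𝔸)B(F)`** (★ `borelHeight_unipotent_mul`, ★ `borelHeight_arithmeticBorel_mul'` — product formula — and `Subgroup.closure_induction`).
[cite: MoeglinWaldspurger1995, I.2.1 and II.1.1] -/
theorem borelHeight_adelicUnipBorel_mul [NeZero N] {x : (quasiSplit F E c N).Adelic} (hx : x ∈ adelicUnipBorelSubgroup F E c N) (h : (quasiSplit F E c N).Adelic) :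
    borelHeight (x * h) = borelHeight h := by
  revert h
  have hx' : x ∈ Subgroup.closure (((adelicUnipotent F E c N : Subgroup (quasiSplit F E c N).Adelic) : Set (quasiSplit F E c N).Adelic) ∪ (ratBorelSubgroup F E c N : Set (quasiSplit F E c N).Adelic)) := by
    rw [← Subgroup.sup_eq_closure]; exact hx
  refine Subgroup.closure_induction (p := fun x _ => ∀ h, borelHeight (x * h) = borelHeight h) ?_ ?_ ?_ ?_ hx'
  · rintro y (hy | hy) h
    · exact borelHeight_unipotent_mul hy h
    · obtain ⟨γ, hγ⟩ := hy.2
      have hmem : (⟨y, ⟨γ, hγ⟩⟩ : (quasiSplit F E c N).arithmeticSubgroup) ∈ arithmeticBorel F E c N := (mem_arithmeticBorel_iff _).2 hy.1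
      exact borelHeight_arithmeticBorel_mul' hmem h
  · intro h; rw [one_mul]
  · intro y z _ _ hy hz h
    rw [mul_assoc, hy, hz]
  · intro y _ hy h
    have := hy (y⁻¹ * h)
    rw [mul_inv_cancel_left] at this
    exact this.symm

/-! ## §3 Continuity, boundedness, height band -/

/-- **(L1) `ψ` IS CONTINUOUS** for a NICE `Φ` (continuous, right-`N(𝔸)`-invariant, vanishing off `C·N(𝔸)` with `C` compact): on a compact neighbourhood `D` of any point the sum is the
FINITE sum over the classes of §1 (L0), each term `h ↦ Φ(h⁻¹q̃)` being continuous. [cite: MoeglinWaldspurger1995, II.1.3] [cite: Garrett2018, §2.10] -/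
theorem continuous_inv_periodization [LocallyCompactSpace (quasiSplit F E c N).Adelic] {Φ : (quasiSplit F E c N).Adelic → ℂ} (hΦc : Continuous Φ)
    {C : Set (quasiSplit F E c N).Adelic} (hC : IsCompact C)
    (hCΦ : ∀ g, g ∉ C * ((adelicUnipotent F E c N : Subgroup (quasiSplit F E c N).Adelic) : Set (quasiSplit F E c N).Adelic) → Φ g = 0) :
    Continuous fun h : (quasiSplit F E c N).Adelic => ∑' q : ↥(arithmeticBorel F E c N) ⧸ ((adelicUnipotent F E c N).subgroupOf (quasiSplit F E c N).arithmeticSubgroup).subgroupOf (arithmeticBorel F E c N),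
        Φ (h⁻¹ * (((q.out : arithmeticBorel F E c N) : (quasiSplit F E c N).arithmeticSubgroup) : (quasiSplit F E c N).Adelic)) := by
  classical
  refine continuous_iff_continuousAt.2 fun h₀ => ?_
  obtain ⟨D, hDc, hDn⟩ := exists_compact_mem_nhds h₀
  obtain ⟨s, hs⟩ := (finite_setOf_exists_apply_ne_zero (Φ := Φ) hC hCΦ hDc).exists_finset_coe
  have hev : (fun h : (quasiSplit F E c N).Adelic => ∑' q : ↥(arithmeticBorel F E c N) ⧸ ((adelicUnipotent F E c N).subgroupOf (quasiSplit F E c N).arithmeticSubgroup).subgroupOf (arithmeticBorel F E c N),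
        Φ (h⁻¹ * (((q.out : arithmeticBorel F E c N) : (quasiSplit F E c N).arithmeticSubgroup) : (quasiSplit F E c N).Adelic))) =ᶠ[𝓝 h₀]
      fun h => ∑ q ∈ s, Φ (h⁻¹ * (((q.out : arithmeticBorel F E c N) : (quasiSplit F E c N).arithmeticSubgroup) : (quasiSplit F E c N).Adelic)) := by
    filter_upwards [hDn] with h hh
    refine tsum_eq_sum fun q hq => ?_
    by_contra hne
    have : q ∈ (s : Set _) := by rw [hs]; exact ⟨h, hh, hne⟩
    exact hq this
  refine (ContinuousAt.congr ?_ hev.symm)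
  exact (continuous_finsetSum s fun q _ => hΦc.comp (continuous_inv.mul continuous_const)).continuousAt

/-- **(L3) `ψ` IS BOUNDED**: `|ψ(h)| ≤ sup_{C⁻¹} |ψ|` — for `h ∈ N(𝔸)B(F)·C⁻¹` by the invariance (L2′), and `ψ(h) = 0` otherwise (L2); `C⁻¹` is compact and `ψ` continuous (L1).
[cite: MoeglinWaldspurger1995, II.1.3] -/
theorem exists_bound_inv_periodization [NeZero N] [LocallyCompactSpace (quasiSplit F E c N).Adelic] {Φ : (quasiSplit F E c N).Adelic → ℂ} (hΦc : Continuous Φ)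
    (hΦ : ∀ (g : (quasiSplit F E c N).Adelic) (u : adelicUnipotent F E c N), Φ (g * u) = Φ g)
    {C : Set (quasiSplit F E c N).Adelic} (hC : IsCompact C)
    (hCΦ : ∀ g, g ∉ C * ((adelicUnipotent F E c N : Subgroup (quasiSplit F E c N).Adelic) : Set (quasiSplit F E c N).Adelic) → Φ g = 0) :
    ∃ M : ℝ, ∀ h : (quasiSplit F E c N).Adelic,
      ‖∑' q : ↥(arithmeticBorel F E c N) ⧸ ((adelicUnipotent F E c N).subgroupOf (quasiSplit F E c N).arithmeticSubgroup).subgroupOf (arithmeticBorel F E c N),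
          Φ (h⁻¹ * (((q.out : arithmeticBorel F E c N) : (quasiSplit F E c N).arithmeticSubgroup) : (quasiSplit F E c N).Adelic))‖ ≤ M := by
  set ψ := (fun h : (quasiSplit F E c N).Adelic => ∑' q : ↥(arithmeticBorel F E c N) ⧸ ((adelicUnipotent F E c N).subgroupOf (quasiSplit F E c N).arithmeticSubgroup).subgroupOf (arithmeticBorel F E c N),
        Φ (h⁻¹ * (((q.out : arithmeticBorel F E c N) : (quasiSplit F E c N).arithmeticSubgroup) : (quasiSplit F E c N).Adelic))) with hψ
  have hcont : Continuous ψ := continuous_inv_periodization hΦc hC hCΦ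
  obtain ⟨M, hM⟩ := hC.inv.exists_bound_of_continuousOn (f := ψ) hcont.continuousOn
  refine ⟨max M 0, fun h => ?_⟩
  by_cases hh : h ∈ ((adelicUnipBorelSubgroup F E c N : Subgroup (quasiSplit F E c N).Adelic) : Set (quasiSplit F E c N).Adelic) * C⁻¹
  · obtain ⟨x, hx, y, hy, rfl⟩ := Set.mem_mul.1 hh
    have h1 : ψ (x * y) = ψ y := inv_periodization_adelicUnipBorel_mul hΦ hx y
    show ‖ψ (x * y)‖ ≤ max M 0
    rw [h1]
    exact (hM y hy).trans (le_max_left _ _)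
  · show ‖ψ h‖ ≤ max M 0
    rw [hψ]
    simp only
    rw [inv_periodization_eq_zero_of_not_mem hCΦ h hh, norm_zero]
    exact le_max_right _ _

/-- **(L4) THE HEIGHT BAND**: there are `0 < a ≤ b` with `a ≤ H(h) ≤ b` whenever `ψ(h) ≠ 0` — `ψ(h) ≠ 0` forces `h = x y` with `x ∈ N(𝔸)B(F)`, `y ∈ C⁻¹` (L2), and `H(x y) = H(y)`
(★ height invariance) lies in the compact image `H(C⁻¹) ⊆ (0, ∞)` (★ `continuous_borelHeight`, ★ `borelHeight_pos`). [cite: MoeglinWaldspurger1995, I.2.1 and II.1.3] -/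
theorem exists_band_of_inv_periodization_ne_zero [NeZero N] {Φ : (quasiSplit F E c N).Adelic → ℂ} {C : Set (quasiSplit F E c N).Adelic} (hC : IsCompact C)
    (hCΦ : ∀ g, g ∉ C * ((adelicUnipotent F E c N : Subgroup (quasiSplit F E c N).Adelic) : Set (quasiSplit F E c N).Adelic) → Φ g = 0) :
    ∃ a b : ℝ≥0, 0 < a ∧ ∀ h : (quasiSplit F E c N).Adelic,
      (∑' q : ↥(arithmeticBorel F E c N) ⧸ ((adelicUnipotent F E c N).subgroupOf (quasiSplit F E c N).arithmeticSubgroup).subgroupOf (arithmeticBorel F E c N),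
          Φ (h⁻¹ * (((q.out : arithmeticBorel F E c N) : (quasiSplit F E c N).arithmeticSubgroup) : (quasiSplit F E c N).Adelic))) ≠ 0 →
        a ≤ borelHeight h ∧ borelHeight h ≤ b := by
  rcases (C⁻¹).eq_empty_or_nonempty with hCe | hCne
  · refine ⟨1, 1, one_pos, fun h hne => absurd (inv_periodization_eq_zero_of_not_mem hCΦ h ?_) hne⟩
    rw [hCe, Set.mul_empty]
    exact Set.notMem_empty h
  · obtain ⟨y₀, hy₀, hmin⟩ := hC.inv.exists_isMinOn hCne continuous_borelHeight.continuousOn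
    obtain ⟨y₁, hy₁, hmax⟩ := hC.inv.exists_isMaxOn hCne continuous_borelHeight.continuousOn
    refine ⟨borelHeight y₀, borelHeight y₁, borelHeight_pos y₀, fun h hne => ?_⟩
    have hh : h ∈ ((adelicUnipBorelSubgroup F E c N : Subgroup (quasiSplit F E c N).Adelic) : Set (quasiSplit F E c N).Adelic) * C⁻¹ := by
      by_contra hn
      exact hne (inv_periodization_eq_zero_of_not_mem hCΦ h hn)
    obtain ⟨x, hx, y, hy, rfl⟩ := Set.mem_mul.1 hh
    rw [borelHeight_adelicUnipBorel_mul hx y]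
    exact ⟨hmin hy, hmax hy⟩

end Summit.HodgeConjecture.HodgeConjecture.Cruxes.H413.K2E1PseudoEisensteinBorelPeriodizationContinuousU2

end
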